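import Summits.BirchSwinnertonDyer.BirchSwinnertonDyer.Theorems.ManinLocalTwoThreeQExpansionExtension
import Summits.BirchSwinnertonDyer.BirchSwinnertonDyer.Theorems.ManinLocalTwoThreeKummerCubeQExpansionPrinciple
import Literature.NumberTheory.Automorphic.UnboundedDenominatorsReductions
import Summits.BirchSwinnertonDyer.BirchSwinnertonDyer.Theorems.ManinLocalTwoThreeMinimalCubeRootIntegral
import Summits.BirchSwinnertonDyer.Rank1Residual.ManinAdditive.UDCKummerWitnessLine
import HarnessLib

/-!
# Integer `q`-series near the cusp for the C3 witness `F = Φ · (Δ^{deg P} P(j))ⁿ` — (QEXN) of -an's witness line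
(route `ManinLocalTwoThree`, crux C3 `ManinPrimeToThreeAtNine` stmt-BirchSwinnertonDyer-22968; cell bsd-f2-manin, C3 LEAD p1 gen 15;
`--supports stmt-BirchSwinnertonDyer-22968`)

-an g38's witness line (`UDCKummerWitnessLine`, typer T-an-44) splits the C3 witness stub (skeleton v24 `stub_kummerCubeRootModularFormWitness`) into
(INT) ∧ (ALG) ∧ (DICT) ∧ (EXT) ∧ (QEXN) ∧ (INV); (QEXN) `IntegralQSeriesNearCusp` is GENERIC bookkeeping: if `Φ = Σ gₘ qᵐ` for `Im τ > B` with
`g ∈ ℤ⟦q⟧` (given as `g ∈ ℚ⟦q⟧` with all denominators `1`) and `F = Φ · (Σ_{i ≤ deg P} pᵢ E₄^{3i} Δ^{deg P − i})ⁿ` for `Im τ > B'`, then `F = Σ bₘ e^{2πiτm}`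
with INTEGER `bₘ` for `Im τ` large.  This file PROVES it (stated inline, the body of -an's `def` verbatim with `kummerPoleKiller P n τ` unfolded;
and BY NAME: `integralQSeriesNearCusp_holds`), together with the two other
generic/closed pieces of the line BY NAME — (QXP) `qExpansionExtensionPrinciple_holds` (the lead's p729478) and (INT) `minimalKummerCubeRootIntegral_holds`
(p3 g15's `MinimalCubeRoot.exists_int_minimalCubeRoot`, p728452) — so that skeleton v25 carries exactly the four OPEN pieces (ALG), (DICT), (EXT), (INV) as stubs:

* `hasSum_intSeries_E₄` / `hasSum_intSeries_discriminant` — `E₄` and `Δ` are sums of INTEGER `q`-series on all of `ℍ` (tree: `E₄_qExpansion_eq`,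
  `exists_discriminant_qExpansion_eq_map`; Mathlib `UpperHalfPlane.hasSum_qExpansion`);
* `hasSum_intSeries_mul/_pow/_sum` — closure of «is the sum of the integer `q`-series `A` at `τ`» under products, powers, finite sums
  (Cauchy products: p2's `hasSum_coeff_mul_pow_mul`);
* `exists_intSeries_poleKiller` — `(Σᵢ pᵢ E₄^{3i} Δ^{d−i})ⁿ` is the sum of ONE integer `q`-series on all of `ℍ`;
* **`integralQSeriesNearCusp`** — (QEXN).

HONEST FRAMING.  Bookkeeping only; (AN2), C3, Manin's conjecture and BSD are NOT proved here.  No definitions, no sorry. [folklore]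
-/

set_option autoImplicit false
-- lint-debt: the directory name repeats the summit name (sibling precedent `ManinLocalTwoThreeUDCGlue.lean`)
set_option linter.dupNamespace false

noncomputable section

open Complex UpperHalfPlane PowerSeries
open scoped Real Topology Manifold MatrixGroups ModularForm

namespace Summit.BirchSwinnertonDyer.BirchSwinnertonDyer.Theorems.ManinLocalTwoThree.IntegralQSeries

open Summit.BirchSwinnertonDyer.BirchSwinnertonDyer.Theorems.ManinLocalTwoThree.KummerCubeSigmaLeaves
  (hasSum_coeff_mul_pow_mul)

/-! ## §1 `E₄` and `Δ` are sums of integer `q`-series on `ℍ` -/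

/-- `E₄ τ = Σ aₘ q(τ)ᵐ` on all of `ℍ` with `a ∈ ℤ⟦q⟧`. [folklore] -/
theorem hasSum_intSeries_E₄ : ∃ A : PowerSeries ℤ, ∀ τ : ℍ,
    HasSum (fun m : ℕ ↦ coeff m (A.map (Int.castRingHom ℂ)) * Function.Periodic.qParam 1 (τ : ℂ) ^ m) (ModularForm.E₄ τ) := by
  refine ⟨1 + 240 * PowerSeries.mk fun n ↦ if n = 0 then (0 : ℤ) else (ArithmeticFunction.sigma 3 n : ℤ), fun τ ↦ ?_⟩
  have : Fact (IsCusp OnePoint.infty 𝒮ℒ) := ⟨(𝒮ℒ).isCusp_of_mem_strictPeriods one_pos one_mem_strictPeriods_SL⟩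
  have h := UpperHalfPlane.hasSum_qExpansion one_pos
    (SlashInvariantFormClass.periodic_comp_ofComplex ModularForm.E₄ one_mem_strictPeriods_SL)
    (ModularFormClass.holo ModularForm.E₄) (ModularFormClass.bdd_at_infty ModularForm.E₄) τ
  have hq : qExpansion 1 ⇑ModularForm.E₄ =
      (1 + 240 * PowerSeries.mk fun n ↦ if n = 0 then (0 : ℤ) else (ArithmeticFunction.sigma 3 n : ℤ)).map (Int.castRingHom ℂ) := by
    rw [Literature.NumberTheory.Automorphic.E₄_qExpansion_eq, map_add, map_one, map_mul, map_ofNat]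
  rw [← hq]
  simpa [smul_eq_mul] using h

/-- `Δ τ = Σ dₘ q(τ)ᵐ` on all of `ℍ` with `d ∈ ℤ⟦q⟧`. [folklore] -/
theorem hasSum_intSeries_discriminant : ∃ D : PowerSeries ℤ, ∀ τ : ℍ,
    HasSum (fun m : ℕ ↦ coeff m (D.map (Int.castRingHom ℂ)) * Function.Periodic.qParam 1 (τ : ℂ) ^ m) (ModularForm.discriminant τ) := by
  obtain ⟨D, hD⟩ := Literature.NumberTheory.Automorphic.exists_discriminant_qExpansion_eq_map
  refine ⟨D, fun τ ↦ ?_⟩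
  have : Fact (IsCusp OnePoint.infty 𝒮ℒ) := ⟨(𝒮ℒ).isCusp_of_mem_strictPeriods one_pos one_mem_strictPeriods_SL⟩
  have h := UpperHalfPlane.hasSum_qExpansion one_pos
    (SlashInvariantFormClass.periodic_comp_ofComplex CuspForm.discriminant one_mem_strictPeriods_SL)
    (ModularFormClass.holo CuspForm.discriminant) (ModularFormClass.bdd_at_infty CuspForm.discriminant) τ
  rw [CuspForm.coe_discriminant] at h
  rw [← hD]
  simpa [smul_eq_mul] using h

/-! ## §2 Closure properties of «`x` is the sum of the integer `q`-series `A` at `q`» -/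

variable {q : ℂ}

/-- Products (Cauchy product; summability in `ℂ` is absolute). [folklore] -/
theorem hasSum_intSeries_mul {A B : PowerSeries ℤ} {x y : ℂ}
    (hA : HasSum (fun m : ℕ ↦ coeff m (A.map (Int.castRingHom ℂ)) * q ^ m) x)
    (hB : HasSum (fun m : ℕ ↦ coeff m (B.map (Int.castRingHom ℂ)) * q ^ m) y) :
    HasSum (fun m : ℕ ↦ coeff m ((A * B).map (Int.castRingHom ℂ)) * q ^ m) (x * y) := by
  rw [map_mul]
  exact hasSum_coeff_mul_pow_mul hA hB

/-- Sums. [folklore] -/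
theorem hasSum_intSeries_add {A B : PowerSeries ℤ} {x y : ℂ}
    (hA : HasSum (fun m : ℕ ↦ coeff m (A.map (Int.castRingHom ℂ)) * q ^ m) x)
    (hB : HasSum (fun m : ℕ ↦ coeff m (B.map (Int.castRingHom ℂ)) * q ^ m) y) :
    HasSum (fun m : ℕ ↦ coeff m ((A + B).map (Int.castRingHom ℂ)) * q ^ m) (x + y) := by
  have h := hA.add hB
  convert h using 2 with m
  rw [map_add, map_add, add_mul]

/-- Integer constants. [folklore] -/
theorem hasSum_intSeries_C (z : ℤ) : HasSum (fun m : ℕ ↦ coeff m ((C z).map (Int.castRingHom ℂ)) * q ^ m) (z : ℂ) := by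
  have h : HasSum (fun m : ℕ ↦ if m = 0 then (z : ℂ) else 0) (z : ℂ) := hasSum_ite_eq 0 (z : ℂ)
  convert h using 2 with m
  rw [map_C, coeff_C]
  split_ifs with hm
  · simp [hm]
  · simp

/-- Integer scalar multiples. [folklore] -/
theorem hasSum_intSeries_C_mul (z : ℤ) {A : PowerSeries ℤ} {x : ℂ}
    (hA : HasSum (fun m : ℕ ↦ coeff m (A.map (Int.castRingHom ℂ)) * q ^ m) x) :
    HasSum (fun m : ℕ ↦ coeff m ((C z * A).map (Int.castRingHom ℂ)) * q ^ m) ((z : ℂ) * x) :=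
  hasSum_intSeries_mul (hasSum_intSeries_C z) hA

/-- Powers. [folklore] -/
theorem hasSum_intSeries_pow {A : PowerSeries ℤ} {x : ℂ}
    (hA : HasSum (fun m : ℕ ↦ coeff m (A.map (Int.castRingHom ℂ)) * q ^ m) x) (k : ℕ) :
    HasSum (fun m : ℕ ↦ coeff m ((A ^ k).map (Int.castRingHom ℂ)) * q ^ m) (x ^ k) := by
  induction k with
  | zero =>
    rw [pow_zero, pow_zero, ← map_one C, show ((1 : ℂ)) = ((1 : ℤ) : ℂ) by norm_num]
    exact hasSum_intSeries_C 1
  | succ k ih =>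
    rw [pow_succ, pow_succ]
    exact hasSum_intSeries_mul ih hA

/-- Finite sums. [folklore] -/
theorem hasSum_intSeries_sum {ι : Type*} (s : Finset ι) {A : ι → PowerSeries ℤ} {x : ι → ℂ}
    (hA : ∀ i ∈ s, HasSum (fun m : ℕ ↦ coeff m ((A i).map (Int.castRingHom ℂ)) * q ^ m) (x i)) :
    HasSum (fun m : ℕ ↦ coeff m ((∑ i ∈ s, A i).map (Int.castRingHom ℂ)) * q ^ m) (∑ i ∈ s, x i) := by
  classical
  induction s using Finset.induction_on with
  | empty =>
    rw [Finset.sum_empty, Finset.sum_empty, ← map_zero C, show ((0 : ℂ)) = ((0 : ℤ) : ℂ) by norm_num]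
    exact hasSum_intSeries_C 0
  | insert i s hi ih =>
    rw [Finset.sum_insert hi, Finset.sum_insert hi]
    exact hasSum_intSeries_add (hA i (Finset.mem_insert_self i s)) (ih fun j hj ↦ hA j (Finset.mem_insert_of_mem hj))

/-! ## §3 The pole killer `(Σᵢ pᵢ E₄^{3i} Δ^{deg P − i})ⁿ` is the sum of one integer `q`-series on all of `ℍ` -/

/-- **The pole killer has an integer `q`-series on `ℍ`.** [folklore] -/
theorem exists_intSeries_poleKiller (P : Polynomial ℤ) (n : ℕ) : ∃ K : PowerSeries ℤ, ∀ τ : ℍ,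
    HasSum (fun m : ℕ ↦ coeff m (K.map (Int.castRingHom ℂ)) * Function.Periodic.qParam 1 (τ : ℂ) ^ m)
      ((∑ i ∈ Finset.range (P.natDegree + 1),
          ((P.coeff i : ℤ) : ℂ) * ModularForm.E₄ τ ^ (3 * i) * ModularForm.discriminant τ ^ (P.natDegree - i)) ^ n) := by
  obtain ⟨A, hA⟩ := hasSum_intSeries_E₄
  obtain ⟨D, hD⟩ := hasSum_intSeries_discriminant
  refine ⟨(∑ i ∈ Finset.range (P.natDegree + 1), C (P.coeff i) * A ^ (3 * i) * D ^ (P.natDegree - i)) ^ n, fun τ ↦ ?_⟩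
  refine hasSum_intSeries_pow (hasSum_intSeries_sum _ fun i _ ↦ ?_) n
  have h1 := hasSum_intSeries_C_mul (P.coeff i) (hasSum_intSeries_pow (hA τ) (3 * i))
  have h2 := hasSum_intSeries_mul h1 (hasSum_intSeries_pow (hD τ) (P.natDegree - i))
  exact h2

/-! ## §4 (QEXN) -/

/-- A rational series with all denominators `1` is the image of an integer series. [folklore] -/
theorem exists_map_eq_of_den_eq_one {g : ℚ⟦X⟧} (hg : ∀ m, (coeff m g).den = 1) :
    ∃ G : PowerSeries ℤ, ∀ m, ((coeff m g : ℚ) : ℂ) = ((coeff m G : ℤ) : ℂ) := by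
  refine ⟨PowerSeries.mk fun m ↦ (coeff m g).num, fun m ↦ ?_⟩
  rw [coeff_mk]
  have h : (coeff m g : ℚ) = ((coeff m g).num : ℚ) := by
    conv_lhs => rw [← Rat.num_div_den (coeff m g), hg m]
    simp
  rw [h]
  push_cast
  rfl

/-- **(QEXN) integer `q`-series of the witness near the cusp** — the body of -an's `UDCKummerWitnessLine.IntegralQSeriesNearCusp` with
`kummerPoleKiller P n τ = (Σ_{i ≤ deg P} pᵢ E₄(τ)^{3i} Δ(τ)^{deg P − i})ⁿ` unfolded: if `Φ = Σ gₘ qᵐ` for `Im τ > B` with `g` integral and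
`F = Φ · killer` for `Im τ > B'`, then `F = Σ bₘ e^{2πiτm}` with integer `bₘ` for `Im τ > max B B'`. [folklore] -/
theorem integralQSeriesNearCusp (Φ F : ℍ → ℂ) (g : ℚ⟦X⟧) (P : Polynomial ℤ) (n : ℕ)
    (hg : ∀ m, (coeff m g).den = 1)
    (hΦ : ∃ B : ℝ, ∀ τ : ℍ, B < τ.im →
      HasSum (fun m : ℕ ↦ ((coeff m g : ℚ) : ℂ) * Function.Periodic.qParam 1 (τ : ℂ) ^ m) (Φ τ))
    (hF : ∃ B : ℝ, ∀ τ : ℍ, B < τ.im → F τ = Φ τ *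
      (∑ i ∈ Finset.range (P.natDegree + 1),
          ((P.coeff i : ℤ) : ℂ) * ModularForm.E₄ τ ^ (3 * i) * ModularForm.discriminant τ ^ (P.natDegree - i)) ^ n) :
    ∃ (b : ℕ → ℤ) (B : ℝ), ∀ τ : ℍ, B < τ.im →
      HasSum (fun m : ℕ ↦ (b m : ℂ) * Complex.exp (2 * Real.pi * Complex.I * (τ : ℂ) * m)) (F τ) := by
  obtain ⟨B₁, hB₁⟩ := hΦ
  obtain ⟨B₂, hB₂⟩ := hF
  obtain ⟨G, hG⟩ := exists_map_eq_of_den_eq_one hg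
  obtain ⟨K, hK⟩ := exists_intSeries_poleKiller P n
  refine ⟨fun m ↦ coeff m (G * K), max B₁ B₂, fun τ hτ ↦ ?_⟩
  have h1 : B₁ < τ.im := lt_of_le_of_lt (le_max_left _ _) hτ
  have h2 : B₂ < τ.im := lt_of_le_of_lt (le_max_right _ _) hτ
  have hΦτ : HasSum (fun m : ℕ ↦ coeff m (G.map (Int.castRingHom ℂ)) * Function.Periodic.qParam 1 (τ : ℂ) ^ m) (Φ τ) := by
    convert hB₁ τ h1 using 2 with m
    rw [coeff_map, hG m]; rfl
  have hprod := hasSum_intSeries_mul hΦτ (hK τ)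
  rw [← hB₂ τ h2] at hprod
  convert hprod using 2 with m
  rw [coeff_map, QExpansionExtension.exp_eq_qParam_pow]
  rfl

/-! ## §5 Three pieces of -an's witness line BY NAME: (QEXN), (QXP), (INT) -/

open Summit.BirchSwinnertonDyer.Rank1Residual.ManinAdditive in
/-- **(QEXN) BY NAME** — `UDCKummerWitnessLine.IntegralQSeriesNearCusp` holds (`kummerPoleKiller` unfolds to the sum of §3). [folklore] -/
theorem integralQSeriesNearCusp_holds : UDCKummerWitnessLine.IntegralQSeriesNearCusp :=
  fun Φ F g P n hg hΦ hF ↦ integralQSeriesNearCusp Φ F g P n hg hΦ hF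

open Summit.BirchSwinnertonDyer.Rank1Residual.ManinAdditive in
/-- **(QXP) BY NAME** — `UDCKummerWitnessLine.QExpansionExtensionPrinciple` holds: the lead's `QExpansionExtension.hasSum_exp_of_hasSum_of_lt_im`
(p729478). [folklore] -/
theorem qExpansionExtensionPrinciple_holds : UDCKummerWitnessLine.QExpansionExtensionPrinciple :=
  fun _f hf _b _B hs τ ↦ QExpansionExtension.hasSum_exp_of_hasSum_of_lt_im hf hs τ

open Summit.BirchSwinnertonDyer.Rank1Residual.ManinAdditive in
/-- **(INT) BY NAME** — `UDCKummerWitnessLine.MinimalKummerCubeRootIntegral` holds: the first three clauses of p3 g15's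
`MinimalCubeRoot.exists_int_minimalCubeRoot` (p728452: Honda at every prime, global Nagell–Lutz for `T`, cube roots `p`-integral for `p ≠ 3`,
(BI) + UFD at `p = 3`). [folklore] -/
theorem minimalKummerCubeRootIntegral_holds : UDCKummerWitnessLine.MinimalKummerCubeRootIntegral := by
  intro W _ _ N _ D a ha X₀ Y₀ hT z hz h hh3 hh0 hb
  obtain ⟨g, hg1, hg2, hg3, _⟩ := MinimalCubeRoot.exists_int_minimalCubeRoot W D a ha X₀ Y₀ hT z hz h hh3 hh0 hb
  exact ⟨g, hg1, hg2, hg3⟩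

end Summit.BirchSwinnertonDyer.BirchSwinnertonDyer.Theorems.ManinLocalTwoThree.IntegralQSeries

end
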